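/-
Copyright (c) 2026 the pub-hodgecm-mathlib formalisation cell (harness21).  Prover seat hodgecm-mathlib-K2E5-p16 (g7), Track B «K2-LIT»,
#184♮ = hLiu418 = `stmt-HodgeConjecture-24832`; S2-asm road (γ) ANCHOR PURE-TENSOR letter PART 2b `K2LiuArchTensorKTypeCharacter`
(LEAD F0P6-plan (g14) BATCH #27 (1); K2Liu-p05 (g5) 13:45:00Z function-level shape; K2E5-p16 (g6) HANDOFF route (i)–(v)): the `K_∞`-TYPE
CHARACTER of the arch values of the frame Gaussian of `𝔻 ⊗ V′` along the SMALL group — for every arch `k` of `U(J^𝔻)(L⁺ ⊗ ℝ)` whose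
sign-frame components are block diagonal, `archUFormPi_𝔻 k σ = kV (a_σ, b_σ)`:
`archSWValue sB Y Φ_Gauss (x · k) = (∏_σ ((det a_σ · det b_σ)^{M₂})^{(t_{w(σ)}+1)/2}) · (∏_σ det a_σ^{q′_σ} · det b_σ^{p′_σ})⁻¹ · archSWValue sB Y Φ_Gauss x`
(`(p′_σ, q′_σ)` the signature of `V′` at `σ`).  THEOREMS ONLY (no `def`, no `instance`, no notation, no `sorry`).
-/
import Summits.HodgeConjecture.HodgeConjecture.Theorems.K2LiuArchTensorKTypeComponents   -- ★ PART 1 `archUFormPi_tensorEmb`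
import Summits.HodgeConjecture.HodgeConjecture.Theorems.K2LiuJunctionCompactPairKType    -- ★ PART 2a `exists_kV_eq_relabel_toBig_kV_one`
import Summits.HodgeConjecture.HodgeConjecture.Theorems.K2LiuArchFrameGaussKType         -- ★ J1 §4 `archSWValue_archFrameGauss_mul_right`
import HarnessLib

/-!
# Crux `HLiu418`, S2-asm (γ) anchor letter PART 2b: the `K_∞`-type character of the frame Gaussian along the small group

Cell `hodgecm-mathlib`, crux item hLiu418 = `stmt-HodgeConjecture-24832` (helper lane `--supports`, count-neutral).

The (F-K′) law ★ J1 §4 `K2LiuArchFrameGaussKType.archSWValue_archFrameGauss_mul_right` reads the right `k`-translate of the arch values of the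
frame Gaussian `Φ_Gauss` of the BIG datum `𝕎 = 𝔻 ⊗ V′` through the abstract datum `hk : placeDiag (archUFormPi_𝕎 k′) = kV (A, B)` of the tensor
image `k′ = ((k, 1_f) ⊗ 1)_∞`, with the scalar `η_t(k′) · (det B)⁻¹`.  This file DISCHARGES `hk` and EVALUATES the scalar for every `k` of
compact type in the small group, place by place:
* §1 (generic sign frames) **`det_archAt_of_archUFormPi_eq_kV`** — if `archUFormPi g v = kV (a, b)` then `det g_{w(v)} = det a · det b`
  (★ `coe_archUForm`, ★ `det_scaleConj`);
* §2 **`det_archAt_tensorEmb_of_kV`** — `det (k′_{w(σ)}) = (det a_σ · det b_σ)^{M₂}` (★ FILE 2b-1 `coe_archAt_archPart_tensorEmb`, `Matrix.det_kronecker`) and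
  **`coe_etaD_tensorEmb_of_kV`** — `η_t(k′) = ∏_σ ((det a_σ · det b_σ)^{M₂})^{(t_{w(σ)}+1)/2}` (★ `coe_archDetZPow`);
* §3 **`archSWValue_archFrameGauss_mul_right_of_kV`** — THE CHARACTER: for ANY place-wise scaling `y_σ` of `V′` compatible with the two sign vectors
  (`hz`, ★ instance `K2LiuArchTensorPlaceSec.signVec_tensor`) the frame identifications `(eP_σ, eQ_σ)` EXIST (★ FILE 2a `sumCongr_tensorEquiv_compatible`),
  the components `archUFormPi_𝕎 k′ σ = relabel eP_σ eQ_σ (toBig (kV (a_σ, b_σ), 1)) = kV (A_σ, B_σ)` (★ PART 1 + ★ PART 2a, `det B_σ = det a_σ^{|NegIdx y_σ|}·det b_σ^{|PosIdx y_σ|}`)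
  assemble by ★ `placeDiag_kV` (`det (sigmaUnitary B) = ∏_σ det B_σ`, ★ `AdelicBaseChange.det_blockDiagonal'`), and ★ J1 §4 gives the displayed law;
  **`archSWValue_archFrameGauss_mul_right_of_kV_cm`** — the same with the CM scaling `y_σ = σ ∘ dV′` (no side hypothesis left).
This is the `hbase` input of the (G3) inclusion of FILE 3 `K2LiuArchSWSpanning` (K2Liu-p05 lineage): the pure tensor `⊗_w a_{σ_T(w)}` is read at
`K_∞` as `C⁻¹ · archSW(Φ_Gauss)|_{K_∞}` with these explicit one-place characters.
References: [KonnoKonno2007, §3.1 (3.1), Lemma 5.2 p. 73]; [Folland1989, §4.2 Prop. (4.39)]; [Paul1998, §1.2 (1.2.1)–(1.2.2) p. 389];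
[Kudla1994, §2]; [BorelJacquet1979, §4.1].
HONEST LABEL: HC_CM is proved only modulo the 7 printed citations (2 remaining named inputs: hLiu418 = stmt-HodgeConjecture-24832,
h413 = stmt-HodgeConjecture-24833) until rung 0 closes; count-neutral helper, closes no socket.
-/

set_option autoImplicit false
set_option linter.dupNamespace false

noncomputable section

open scoped Matrix Kronecker Classical
open NumberField NumberField.InfinitePlace NumberField.mixedEmbedding IsDedekindDomain

namespace Summit.HodgeConjecture.HodgeConjecture.Cruxes.HLiu418.K2LiuArchTensorKTypeCharacter

open Literature.NumberTheory.Automorphic Literature.NumberTheory.Automorphic.UnitaryGroup Literature.NumberTheory.Weil1964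
open Literature.RepresentationTheory.KonnoKonno2007 Literature.RepresentationTheory.KonnoKonno2007.RealDualPair
open Literature.RepresentationTheory.HeisenbergGroup Literature.Analysis.SegalBargmann

/-! ## §1 (generic sign frames) the determinant of a sign-block compact place component -/

section Generic

variable {F : Type} [Field F] [NumberField F] (E : Type) [Field E] [NumberField E] [Algebra F E] (c : E ≃ₐ[F] E)
  (N : ℕ) (hc : c ≠ 1)
  (wOf : {v : InfinitePlace F // v.IsReal} → {w : InfinitePlace E // w.IsComplex})
  (hw : ∀ v, c • (wOf v).1 = (wOf v).1) (hover : ∀ v, (wOf v).1.comap (algebraMap F E) = v.1)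
  (t₀ : Fin N → F) (ht0 : ∀ j, t₀ j ≠ 0) {T : Matrix (Fin N) (Fin N) F} (hTd : T = Matrix.diagonal t₀)
  {J : Matrix (Fin N) (Fin N) E} (hJ : J = T.map (algebraMap F E)) {δ : E} (hcδ : c δ = -δ) (hδ : δ ≠ 0)

/-- **`det g_{w(v)} = det a · det b` WHEN `archUFormPi g v = kV (a, b)`**: the sign-frame matrix of the place component is
`reindex (signSplit x_v)² (D g_{w(v)} D⁻¹)` (★ `coe_archUForm`, `D` the adapted scaling, ★ `det_scaleConj`), and `kV (a, b) = diag(a, b)`.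
[cite: Folland1989, §4.2 Prop. (4.39)] [cite: KonnoKonno2007, §3.1 (3.1)] -/
theorem det_archAt_of_archUFormPi_eq_kV (g : UnitaryGroup.arch F E c N J) (v : {v : InfinitePlace F // v.IsReal})
    (k : Matrix.unitaryGroup (PosIdx (signVec wOf t₀ δ v)) ℂ × Matrix.unitaryGroup (NegIdx (signVec wOf t₀ δ v)) ℂ)
    (hk : archUFormPi E c N hc wOf hw hover t₀ ht0 hTd hJ hcδ hδ g v = UForm.kV _ _ k) :
    (((archAt F E c N J (wOf v) (hw v) hc g : archLocal E N J (wOf v)) : GL (Fin N) ℂ) : Matrix (Fin N) (Fin N) ℂ).det =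
      (k.1 : Matrix (PosIdx (signVec wOf t₀ δ v)) (PosIdx (signVec wOf t₀ δ v)) ℂ).det *
        (k.2 : Matrix (NegIdx (signVec wOf t₀ δ v)) (NegIdx (signVec wOf t₀ δ v)) ℂ).det := by
  have hM := congrArg (fun u : UForm (PosIdx (signVec wOf t₀ δ v)) (NegIdx (signVec wOf t₀ δ v)) =>
    (((u : GL (PosIdx (signVec wOf t₀ δ v) ⊕ NegIdx (signVec wOf t₀ δ v)) ℂ) :
      Matrix (PosIdx (signVec wOf t₀ δ v) ⊕ NegIdx (signVec wOf t₀ δ v)) (PosIdx (signVec wOf t₀ δ v) ⊕ NegIdx (signVec wOf t₀ δ v)) ℂ)).det) hk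
  rw [archUFormPi_apply, coe_archUForm, archPart_archToAdelic, Matrix.det_reindex_self,
    det_scaleConj _ (sqrtAbs_signVec_ne_zero hc hw hcδ hδ ht0 v), UForm.coe_kV, Matrix.det_fromBlocks_zero₂₁] at hM
  exact hM

end Generic

/-! ## §2 The place determinants and the twist character of the tensor image of a compact-type element -/

section Tensor

open Literature.NumberTheory.GelbartRogawski1991 Literature.NumberTheory.GelbartRogawski1991.UnitaryDualPair
open Literature.NumberTheory.GelbartRogawski1991.UnitaryDualPair.LocalSplitting
open Literature.NumberTheory.GelbartRogawski1991.GRConstruction Literature.NumberTheory.K2Lit.SiegelDoubled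
open Literature.NumberTheory.GaloisRepresentations Literature.RepresentationTheory.HarrisKudlaSweet1996
open Summit.HodgeConjecture.HodgeConjecture.Cruxes.HLiu418 Summit.HodgeConjecture.HodgeConjecture.Cruxes.HLiu418.K2LiuArchSectionPlaceBlock
open Summit.HodgeConjecture.HodgeConjecture.Cruxes.HLiu418.K2LiuArchSWImageDefs
open Summit.HodgeConjecture.HodgeConjecture.Cruxes.HLiu418.K2LiuArchFrameGaussKType

variable (L : Type) [Field L] [NumberField L] [IsCMField L]
variable {N M n : ℕ} (e : Fin N × Fin M ≃ Fin n)
  (dV : Fin N → L) (hdV : ∀ i, IsCMField.complexConj L (dV i) = dV i) (hdV0 : ∀ i, dV i ≠ 0)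
  (dW : Fin M → L) (hdW : ∀ i, IsCMField.complexConj L (dW i) = dW i) (hdW0 : ∀ i, dW i ≠ 0)
variable {M₂ M' n' : ℕ} (eW : Fin M × Fin M₂ ≃ Fin M') (e' : Fin N × Fin M' ≃ Fin n')
  (dV' : Fin M₂ → L) (hdV' : ∀ k, IsCMField.complexConj L (dV' k) = dV' k) (hdV'0 : ∀ k, dV' k ≠ 0)

/-- **`det (k′_{w(σ)}) = (det a_σ · det b_σ)^{M₂}`** for the tensor image `k′ = ((k, 1_f) ⊗ 1)_∞` of an arch `k` with `archUFormPi_𝔻 k σ = kV (a_σ, b_σ)`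
(★ FILE 2b-1 `coe_archAt_archPart_tensorEmb`: `k′_{w} = reindex epsD² (k_w ⊗ₖ 1_{M₂})`, `Matrix.det_kronecker`, §1).
[cite: KonnoKonno2007, Lemma 5.2 p. 73] [cite: Kudla1994, §2 (doubled space, Siegel parabolic)] -/
theorem det_archAt_tensorEmb_of_kV (σ : {v : InfinitePlace (Fp L) // v.IsReal})
    (k : UnitaryGroup.arch (Fp L) L (IsCMField.complexConj L) (n + n) (hermD L e dV hdV dW hdW))
    (a : Matrix.unitaryGroup (PosIdx (signVec (cmPlaceOver L)
      (fun k => Sum.elim (cmGramEntry L e dV hdV dW hdW) (-cmGramEntry L e dV hdV dW hdW) ((e₂ n).symm k)) (imagUnit L) σ)) ℂ)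
    (b : Matrix.unitaryGroup (NegIdx (signVec (cmPlaceOver L)
      (fun k => Sum.elim (cmGramEntry L e dV hdV dW hdW) (-cmGramEntry L e dV hdV dW hdW) ((e₂ n).symm k)) (imagUnit L) σ)) ℂ)
    (hkσ : archUFormPi L (IsCMField.complexConj L) (n + n) (IsCMField.complexConj_ne_one L) (cmPlaceOver L) (cmPlaceOver_smul L)
        (cmPlaceOver_comap L) _ (gramD_gram_realDiagonal_entry_ne_zero L e dV hdV dW hdW hdV0 hdW0) (gramD_eq_diagonal_cm L e dV hdV dW hdW)
        (J := hermD L e dV hdV dW hdW) rfl (complexConj_imagUnit L) (imagUnit_ne_zero L) k σ = UForm.kV _ _ (a, b)) :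
    (((UnitaryGroup.archAt (Fp L) L (IsCMField.complexConj L) (n' + n')
        (hermD L e' dV hdV (tensorFrame L dW eW dV') (tensorFrame_real L dW hdW eW dV' hdV')) (cmPlaceOver L σ) (cmPlaceOver_smul L σ)
        (IsCMField.complexConj_ne_one L)
        (UnitaryGroup.archPart (Fp L) L (IsCMField.complexConj L) (n' + n')
          (hermD L e' dV hdV (tensorFrame L dW eW dV') (tensorFrame_real L dW hdW eW dV' hdV'))
          (tensorEmb L e dV hdV dW hdW eW e' dV' hdV'
            (UnitaryGroup.archToAdelic (Fp L) L (IsCMField.complexConj L) (n + n) (hermD L e dV hdV dW hdW) k : HA L e dV hdV dW hdW))) :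
        UnitaryGroup.archLocal L (n' + n') (hermD L e' dV hdV (tensorFrame L dW eW dV') (tensorFrame_real L dW hdW eW dV' hdV')) (cmPlaceOver L σ)) :
        GL (Fin (n' + n')) ℂ) : Matrix (Fin (n' + n')) (Fin (n' + n')) ℂ).det =
      (a.1.det * b.1.det) ^ M₂ := by
  rw [K2LiuArchTensorEmbArchComponent.coe_archAt_archPart_tensorEmb, Matrix.det_reindex_self, Matrix.det_kronecker, Matrix.det_one, one_pow,
    mul_one, Fintype.card_fin, UnitaryGroup.archPart_archToAdelic,
    det_archAt_of_archUFormPi_eq_kV L (IsCMField.complexConj L) (n + n) (IsCMField.complexConj_ne_one L) (cmPlaceOver L) (cmPlaceOver_smul L)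
      (cmPlaceOver_comap L) _ (gramD_gram_realDiagonal_entry_ne_zero L e dV hdV dW hdW hdV0 hdW0) (gramD_eq_diagonal_cm L e dV hdV dW hdW)
      (J := hermD L e dV hdV dW hdW) rfl (complexConj_imagUnit L) (imagUnit_ne_zero L) k σ (a, b) hkσ]

/-- **`η_t(k′) = ∏_σ ((det a_σ · det b_σ)^{M₂})^{(t_{w(σ)}+1)/2}`** for the tensor image `k′` of an arch `k` all of whose sign-frame components are block
diagonal, `archUFormPi_𝔻 k σ = kV (a_σ, b_σ)` (`etaD = archDetZPow`, ★ `coe_archDetZPow`, the previous lemma place by place).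
[cite: Paul1998, §1.2 (1.2.1)–(1.2.2) p. 389 L11–29] [cite: KonnoKonno2007, Lemma 5.2 p. 73] -/
theorem coe_etaD_tensorEmb_of_kV (t : InfinitePlace L → ℤ)
    (k : UnitaryGroup.arch (Fp L) L (IsCMField.complexConj L) (n + n) (hermD L e dV hdV dW hdW))
    (a : ∀ σ : {v : InfinitePlace (Fp L) // v.IsReal}, Matrix.unitaryGroup (PosIdx (signVec (cmPlaceOver L)
      (fun k => Sum.elim (cmGramEntry L e dV hdV dW hdW) (-cmGramEntry L e dV hdV dW hdW) ((e₂ n).symm k)) (imagUnit L) σ)) ℂ)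
    (b : ∀ σ : {v : InfinitePlace (Fp L) // v.IsReal}, Matrix.unitaryGroup (NegIdx (signVec (cmPlaceOver L)
      (fun k => Sum.elim (cmGramEntry L e dV hdV dW hdW) (-cmGramEntry L e dV hdV dW hdW) ((e₂ n).symm k)) (imagUnit L) σ)) ℂ)
    (hkσ : ∀ σ, archUFormPi L (IsCMField.complexConj L) (n + n) (IsCMField.complexConj_ne_one L) (cmPlaceOver L) (cmPlaceOver_smul L)
        (cmPlaceOver_comap L) _ (gramD_gram_realDiagonal_entry_ne_zero L e dV hdV dW hdW hdV0 hdW0) (gramD_eq_diagonal_cm L e dV hdV dW hdW)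
        (J := hermD L e dV hdV dW hdW) rfl (complexConj_imagUnit L) (imagUnit_ne_zero L) k σ = UForm.kV _ _ (a σ, b σ)) :
    ((etaD L e' dV hdV (tensorFrame L dW eW dV') (tensorFrame_real L dW hdW eW dV' hdV') t
        (UnitaryGroup.archPart (Fp L) L (IsCMField.complexConj L) (n' + n')
          (hermD L e' dV hdV (tensorFrame L dW eW dV') (tensorFrame_real L dW hdW eW dV' hdV'))
          (tensorEmb L e dV hdV dW hdW eW e' dV' hdV'
            (UnitaryGroup.archToAdelic (Fp L) L (IsCMField.complexConj L) (n + n) (hermD L e dV hdV dW hdW) k : HA L e dV hdV dW hdW))) : ℂˣ) : ℂ) =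
      ∏ σ : {v : InfinitePlace (Fp L) // v.IsReal},
        (((a σ).1.det * (b σ).1.det) ^ M₂) ^ ((t (cmPlaceOver L σ).1 + 1) / 2) := by
  rw [etaD, UnitaryGroup.coe_archDetZPow]
  exact Finset.prod_congr rfl fun σ _ => by
    rw [det_archAt_tensorEmb_of_kV L e dV hdV hdV0 dW hdW hdW0 eW e' dV' hdV' σ k (a σ) (b σ) (hkσ σ)]

end Tensor

/-! ## §3 The `K_∞`-type character of the arch values of the frame Gaussian along the small group -/

section Character

open Literature.NumberTheory.GelbartRogawski1991 Literature.NumberTheory.GelbartRogawski1991.UnitaryDualPair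
open Literature.NumberTheory.GelbartRogawski1991.UnitaryDualPair.LocalSplitting
open Literature.NumberTheory.GelbartRogawski1991.GRConstruction Literature.NumberTheory.K2Lit.SiegelDoubled
open Literature.NumberTheory.GaloisRepresentations Literature.RepresentationTheory.HarrisKudlaSweet1996
open Summit.HodgeConjecture.HodgeConjecture.Cruxes.HLiu418 Summit.HodgeConjecture.HodgeConjecture.Cruxes.HLiu418.K2LiuArchSectionPlaceBlock
open Summit.HodgeConjecture.HodgeConjecture.Cruxes.HLiu418.K2LiuArchSWImageDefs
open Summit.HodgeConjecture.HodgeConjecture.Cruxes.HLiu418.K2LiuArchFrameGaussKType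

variable (L : Type) [Field L] [NumberField L] [IsCMField L]
variable {N M n : ℕ} (e : Fin N × Fin M ≃ Fin n)
  (dV : Fin N → L) (hdV : ∀ i, IsCMField.complexConj L (dV i) = dV i) (hdV0 : ∀ i, dV i ≠ 0)
  (dW : Fin M → L) (hdW : ∀ i, IsCMField.complexConj L (dW i) = dW i) (hdW0 : ∀ i, dW i ≠ 0)
variable {M₂ M' n' : ℕ} (eW : Fin M × Fin M₂ ≃ Fin M') (e' : Fin N × Fin M' ≃ Fin n')
  (dV' : Fin M₂ → L) (hdV' : ∀ k, IsCMField.complexConj L (dV' k) = dV' k) (hdV'0 : ∀ k, dV' k ≠ 0)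

/-- **THE `K_∞`-TYPE CHARACTER OF THE FRAME GAUSSIAN ALONG THE SMALL GROUP.**  For the big datum `𝕎 = 𝔻 ⊗ V′`, a `χ`-normalised `sB`, a finite test
vector `Y`, and an arch `k` of the SMALL group all of whose sign-frame components are block diagonal, `archUFormPi_𝔻 k σ = kV (a_σ, b_σ)`:
`archSWValue sB Y Φ_Gauss (x · k) = ((∏_σ ((det a_σ · det b_σ)^{M₂})^{(t_{w(σ)}+1)/2}) · (∏_σ det a_σ^{|NegIdx y_σ|} · det b_σ^{|PosIdx y_σ|})⁻¹) · archSWValue sB Y Φ_Gauss x`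
for every arch `x`, for ANY place-wise scaling `y_σ` of `V′` with `x^𝕎_σ = x^𝔻_σ ⊗ y_σ` (`hz`; ★ instance `signVec_tensor`: `y_σ = σ ∘ dV′`) — the frame
identifications exist by ★ FILE 2a `sumCongr_tensorEquiv_compatible`, the components of `k′` are `kV (A_σ, B_σ)` by ★ PART 1 + ★ PART 2a, they assemble by
★ `placeDiag_kV`, and ★ J1 §4 applies with `η_t(k′)` from §2 and `det (sigmaUnitary B) = ∏_σ det B_σ` (★ `AdelicBaseChange.det_blockDiagonal'`).
[cite: KonnoKonno2007, §3.1 (3.1), Lemma 5.2 p. 73] [cite: Folland1989, §4.2 Prop. (4.39)] [cite: Paul1998, §1.2 (1.2.1)–(1.2.2) p. 389] -/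
theorem archSWValue_archFrameGauss_mul_right_of_kV {χ : HeckeCharacter L} (hχu : χ.IsUnitary) (hχs : IsSplittingChar L 1 χ)
    {sB : HA L e' dV hdV (tensorFrame L dW eW dV') (tensorFrame_real L dW hdW eW dV' hdV') →*
      MpD L e' dV hdV (tensorFrame L dW eW dV') (tensorFrame_real L dW hdW eW dV' hdV')}
    (hsB : IsDoubledWeilRep L e' dV hdV hdV0 (tensorFrame L dW eW dV') (tensorFrame_real L dW hdW eW dV' hdV')
      (tensorFrame_ne_zero L dW eW dV' hdW0 hdV'0) χ sB)
    {t : InfinitePlace L → ℤ} (ht : χ.HasUnitaryArchType t 0) (hodd : ∀ w, Odd (t w))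
    (Y : LocalSBFamily (Fp L) (Fin (n' + n')))
    (x k : UnitaryGroup.arch (Fp L) L (IsCMField.complexConj L) (n + n) (hermD L e dV hdV dW hdW))
    (a : ∀ σ : {v : InfinitePlace (Fp L) // v.IsReal}, Matrix.unitaryGroup (PosIdx (signVec (cmPlaceOver L)
      (fun k => Sum.elim (cmGramEntry L e dV hdV dW hdW) (-cmGramEntry L e dV hdV dW hdW) ((e₂ n).symm k)) (imagUnit L) σ)) ℂ)
    (b : ∀ σ : {v : InfinitePlace (Fp L) // v.IsReal}, Matrix.unitaryGroup (NegIdx (signVec (cmPlaceOver L)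
      (fun k => Sum.elim (cmGramEntry L e dV hdV dW hdW) (-cmGramEntry L e dV hdV dW hdW) ((e₂ n).symm k)) (imagUnit L) σ)) ℂ)
    (hkσ : ∀ σ, archUFormPi L (IsCMField.complexConj L) (n + n) (IsCMField.complexConj_ne_one L) (cmPlaceOver L) (cmPlaceOver_smul L)
        (cmPlaceOver_comap L) _ (gramD_gram_realDiagonal_entry_ne_zero L e dV hdV dW hdW hdV0 hdW0) (gramD_eq_diagonal_cm L e dV hdV dW hdW)
        (J := hermD L e dV hdV dW hdW) rfl (complexConj_imagUnit L) (imagUnit_ne_zero L) k σ = UForm.kV _ _ (a σ, b σ))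
    (y : {v : InfinitePlace (Fp L) // v.IsReal} → Fin M₂ → ℝ) (hy : ∀ σ k, y σ k ≠ 0)
    (hz : ∀ σ j, signVec (cmPlaceOver L)
        (fun k => Sum.elim (cmGramEntry L e' dV hdV (tensorFrame L dW eW dV') (tensorFrame_real L dW hdW eW dV' hdV'))
          (-cmGramEntry L e' dV hdV (tensorFrame L dW eW dV') (tensorFrame_real L dW hdW eW dV' hdV')) ((e₂ n').symm k))
        (imagUnit L) σ j =
      signVec (cmPlaceOver L)
          (fun k => Sum.elim (cmGramEntry L e dV hdV dW hdW) (-cmGramEntry L e dV hdV dW hdW) ((e₂ n).symm k)) (imagUnit L) σ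
          ((epsD e eW e').symm j).1 * y σ ((epsD e eW e').symm j).2) :
    archSWValue L e dV hdV hdV0 dW hdW hdW0 eW e' dV' hdV' hdV'0 sB Y
        (archFrameGauss L e' dV hdV hdV0 (tensorFrame L dW eW dV') (tensorFrame_real L dW hdW eW dV' hdV') (tensorFrame_ne_zero L dW eW dV' hdW0 hdV'0)) (x * k) =
      ((∏ σ : {v : InfinitePlace (Fp L) // v.IsReal},
          (((a σ).1.det * (b σ).1.det) ^ M₂) ^ ((t (cmPlaceOver L σ).1 + 1) / 2)) *
        (∏ σ : {v : InfinitePlace (Fp L) // v.IsReal},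
          ((a σ).1.det ^ Fintype.card (NegIdx (y σ)) * (b σ).1.det ^ Fintype.card (PosIdx (y σ))))⁻¹) *
        archSWValue L e dV hdV hdV0 dW hdW hdW0 eW e' dV' hdV' hdV'0 sB Y
          (archFrameGauss L e' dV hdV hdV0 (tensorFrame L dW eW dV') (tensorFrame_real L dW hdW eW dV' hdV') (tensorFrame_ne_zero L dW eW dV' hdW0 hdV'0)) x := by
  -- the sign vectors of `𝔻` do not vanish
  have hx : ∀ σ i, signVec (cmPlaceOver L)
      (fun k => Sum.elim (cmGramEntry L e dV hdV dW hdW) (-cmGramEntry L e dV hdV dW hdW) ((e₂ n).symm k)) (imagUnit L) σ i ≠ 0 :=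
    fun σ => signVec_ne_zero (IsCMField.complexConj_ne_one L) (cmPlaceOver_smul L) (complexConj_imagUnit L) (imagUnit_ne_zero L)
      (gramD_gram_realDiagonal_entry_ne_zero L e dV hdV dW hdW hdV0 hdW0) σ
  -- frame identifications compatible with the two sign splittings exist at every real place (★ FILE 2a, ★ J0's tensor sign equivalences)
  have hEx : ∀ σ : {v : InfinitePlace (Fp L) // v.IsReal}, ∃ (eP : (PosIdx (signVec (cmPlaceOver L)
          (fun k => Sum.elim (cmGramEntry L e dV hdV dW hdW) (-cmGramEntry L e dV hdV dW hdW) ((e₂ n).symm k)) (imagUnit L) σ) × PosIdx (y σ)) ⊕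
        (NegIdx (signVec (cmPlaceOver L)
          (fun k => Sum.elim (cmGramEntry L e dV hdV dW hdW) (-cmGramEntry L e dV hdV dW hdW) ((e₂ n).symm k)) (imagUnit L) σ) × NegIdx (y σ)) ≃
      PosIdx (signVec (cmPlaceOver L)
        (fun k => Sum.elim (cmGramEntry L e' dV hdV (tensorFrame L dW eW dV') (tensorFrame_real L dW hdW eW dV' hdV'))
          (-cmGramEntry L e' dV hdV (tensorFrame L dW eW dV') (tensorFrame_real L dW hdW eW dV' hdV')) ((e₂ n').symm k))
        (imagUnit L) σ))
      (eQ : (PosIdx (signVec (cmPlaceOver L)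
          (fun k => Sum.elim (cmGramEntry L e dV hdV dW hdW) (-cmGramEntry L e dV hdV dW hdW) ((e₂ n).symm k)) (imagUnit L) σ) × NegIdx (y σ)) ⊕
        (NegIdx (signVec (cmPlaceOver L)
          (fun k => Sum.elim (cmGramEntry L e dV hdV dW hdW) (-cmGramEntry L e dV hdV dW hdW) ((e₂ n).symm k)) (imagUnit L) σ) × PosIdx (y σ)) ≃
      NegIdx (signVec (cmPlaceOver L)
        (fun k => Sum.elim (cmGramEntry L e' dV hdV (tensorFrame L dW eW dV') (tensorFrame_real L dW hdW eW dV' hdV'))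
          (-cmGramEntry L e' dV hdV (tensorFrame L dW eW dV') (tensorFrame_real L dW hdW eW dV' hdV')) ((e₂ n').symm k))
        (imagUnit L) σ)),
      ∀ i, (dpEquiv _ _ _ _).symm ((eP.sumCongr eQ).symm i) =
      (signSplit (signVec (cmPlaceOver L)
          (fun k => Sum.elim (cmGramEntry L e dV hdV dW hdW) (-cmGramEntry L e dV hdV dW hdW) ((e₂ n).symm k)) (imagUnit L) σ)
        ((epsD e eW e').symm ((signSplit (signVec (cmPlaceOver L)
          (fun k => Sum.elim (cmGramEntry L e' dV hdV (tensorFrame L dW eW dV') (tensorFrame_real L dW hdW eW dV' hdV'))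
            (-cmGramEntry L e' dV hdV (tensorFrame L dW eW dV') (tensorFrame_real L dW hdW eW dV' hdV')) ((e₂ n').symm k))
          (imagUnit L) σ)).symm i)).1,
       signSplit (y σ) ((epsD e eW e').symm ((signSplit (signVec (cmPlaceOver L)
          (fun k => Sum.elim (cmGramEntry L e' dV hdV (tensorFrame L dW eW dV') (tensorFrame_real L dW hdW eW dV' hdV'))
            (-cmGramEntry L e' dV hdV (tensorFrame L dW eW dV') (tensorFrame_real L dW hdW eW dV' hdV')) ((e₂ n').symm k))
          (imagUnit L) σ)).symm i)).2) :=
    fun σ => ⟨_, _, K2LiuArchTensorFrameChase.sumCongr_tensorEquiv_compatible _ (y σ) (epsD e eW e') (hx σ) (hy σ) _ (hz σ)⟩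
  choose eP eQ hE using hEx
  -- (ii) the relabelled junction images of `(kV (a_σ, b_σ), 1)` are in the maximal compact, with explicit block determinants (★ PART 2a)
  choose K hK hK1 hK2 using fun σ =>
    K2LiuJunctionCompactPairKType.exists_kV_eq_relabel_toBig_kV_one (R := PosIdx (y σ)) (S := NegIdx (y σ)) (a σ) (b σ) (eP σ) (eQ σ)
  -- (i) the sign-frame components of `k′` (★ PART 1 + `hkσ` + (ii))
  have hcomp : archUFormPi L (IsCMField.complexConj L) (n' + n') (IsCMField.complexConj_ne_one L) (cmPlaceOver L) (cmPlaceOver_smul L)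
        (cmPlaceOver_comap L) _
        (gramD_gram_realDiagonal_entry_ne_zero L e' dV hdV (tensorFrame L dW eW dV') (tensorFrame_real L dW hdW eW dV' hdV') hdV0
          (tensorFrame_ne_zero L dW eW dV' hdW0 hdV'0))
        (gramD_eq_diagonal_cm L e' dV hdV (tensorFrame L dW eW dV') (tensorFrame_real L dW hdW eW dV' hdV'))
        (J := hermD L e' dV hdV (tensorFrame L dW eW dV') (tensorFrame_real L dW hdW eW dV' hdV')) rfl
        (complexConj_imagUnit L) (imagUnit_ne_zero L)
        (UnitaryGroup.archPart (Fp L) L (IsCMField.complexConj L) (n' + n')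
          (hermD L e' dV hdV (tensorFrame L dW eW dV') (tensorFrame_real L dW hdW eW dV' hdV'))
          (tensorEmb L e dV hdV dW hdW eW e' dV' hdV'
            (UnitaryGroup.archToAdelic (Fp L) L (IsCMField.complexConj L) (n + n) (hermD L e dV hdV dW hdW) k : HA L e dV hdV dW hdW))) =
      fun σ => UForm.kV _ _ ((K σ).1, (K σ).2) := by
    funext σ
    rw [K2LiuArchTensorKTypeComponents.archUFormPi_tensorEmb L e dV hdV dW hdW eW e' dV' hdV' hdV0 hdW0 hdV'0 σ k (y σ) (hy σ) (hz σ)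
      (eP σ) (eQ σ) (hE σ), hkσ σ, hK σ]
  -- (iii) they assemble to a sign-block compact element of the big arch group (★ `placeDiag_kV`)
  have hk : UForm.placeDiag (archUFormPi L (IsCMField.complexConj L) (n' + n') (IsCMField.complexConj_ne_one L) (cmPlaceOver L) (cmPlaceOver_smul L)
        (cmPlaceOver_comap L)
        (fun k => Sum.elim (cmGramEntry L e' dV hdV (tensorFrame L dW eW dV') (tensorFrame_real L dW hdW eW dV' hdV'))
          (-cmGramEntry L e' dV hdV (tensorFrame L dW eW dV') (tensorFrame_real L dW hdW eW dV' hdV')) ((LocalSplitting.e₂ n').symm k))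
        (gramD_gram_realDiagonal_entry_ne_zero L e' dV hdV (tensorFrame L dW eW dV') (tensorFrame_real L dW hdW eW dV' hdV') hdV0
          (tensorFrame_ne_zero L dW eW dV' hdW0 hdV'0))
        (gramD_eq_diagonal_cm L e' dV hdV (tensorFrame L dW eW dV') (tensorFrame_real L dW hdW eW dV' hdV'))
        (J := hermD L e' dV hdV (tensorFrame L dW eW dV') (tensorFrame_real L dW hdW eW dV' hdV')) rfl (complexConj_imagUnit L) (imagUnit_ne_zero L)
        (UnitaryGroup.archPart (Fp L) L (IsCMField.complexConj L) (n' + n')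
          (hermD L e' dV hdV (tensorFrame L dW eW dV') (tensorFrame_real L dW hdW eW dV' hdV'))
          (tensorEmb L e dV hdV dW hdW eW e' dV' hdV'
            (UnitaryGroup.archToAdelic (Fp L) L (IsCMField.complexConj L) (n + n) (hermD L e dV hdV dW hdW) k : HA L e dV hdV dW hdW)))) =
      UForm.kV _ _ (sigmaUnitary (fun σ => (K σ).1), sigmaUnitary (fun σ => (K σ).2)) := by
    rw [hcomp]
    exact placeDiag_kV _ _
  -- the two scalars of ★ J1 §4: `det (sigmaUnitary B) = ∏_σ det B_σ` and `η_t(k′)` (§2)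
  have hB : (Subtype.val (sigmaUnitary fun σ => (K σ).2)).det =
      ∏ σ : {v : InfinitePlace (Fp L) // v.IsReal},
        ((a σ).1.det ^ Fintype.card (NegIdx (y σ)) * (b σ).1.det ^ Fintype.card (PosIdx (y σ))) := by
    rw [coe_sigmaUnitary, Literature.NumberTheory.AdelicBaseChange.det_blockDiagonal']
    exact Finset.prod_congr rfl fun σ _ => hK2 σ
  rw [archSWValue_archFrameGauss_mul_right L e dV hdV hdV0 dW hdW hdW0 eW e' dV' hdV' hdV'0 hχu hχs hsB ht hodd Y x k _ _ hk, hB,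
    coe_etaD_tensorEmb_of_kV L e dV hdV hdV0 dW hdW hdW0 eW e' dV' hdV' t k a b hkσ]

/-- **THE CHARACTER WITH THE CM SCALING `y_σ = σ ∘ dV′`** (★ `K2LiuArchTensorPlaceSec.signVec_tensor` discharges `hz`; `dV′ k ≠ 0` discharges `hy`):
`archSWValue sB Y Φ_Gauss (x · k) = ((∏_σ ((det a_σ · det b_σ)^{M₂})^{(t_{w(σ)}+1)/2}) · (∏_σ det a_σ^{q′_σ} · det b_σ^{p′_σ})⁻¹) · archSWValue sB Y Φ_Gauss x`,
`p′_σ = #{k | 0 < σ(dV′_k)}`, `q′_σ = #{k | ¬ 0 < σ(dV′_k)}` — no side hypothesis left besides the compact type `hkσ`.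
[cite: KonnoKonno2007, §3.1 (3.1), Lemma 5.2 p. 73] [cite: Folland1989, §4.2 Prop. (4.39)] [cite: Paul1998, §1.2 (1.2.1)–(1.2.2) p. 389] -/
theorem archSWValue_archFrameGauss_mul_right_of_kV_cm {χ : HeckeCharacter L} (hχu : χ.IsUnitary) (hχs : IsSplittingChar L 1 χ)
    {sB : HA L e' dV hdV (tensorFrame L dW eW dV') (tensorFrame_real L dW hdW eW dV' hdV') →*
      MpD L e' dV hdV (tensorFrame L dW eW dV') (tensorFrame_real L dW hdW eW dV' hdV')}
    (hsB : IsDoubledWeilRep L e' dV hdV hdV0 (tensorFrame L dW eW dV') (tensorFrame_real L dW hdW eW dV' hdV')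
      (tensorFrame_ne_zero L dW eW dV' hdW0 hdV'0) χ sB)
    {t : InfinitePlace L → ℤ} (ht : χ.HasUnitaryArchType t 0) (hodd : ∀ w, Odd (t w))
    (Y : LocalSBFamily (Fp L) (Fin (n' + n')))
    (x k : UnitaryGroup.arch (Fp L) L (IsCMField.complexConj L) (n + n) (hermD L e dV hdV dW hdW))
    (a : ∀ σ : {v : InfinitePlace (Fp L) // v.IsReal}, Matrix.unitaryGroup (PosIdx (signVec (cmPlaceOver L)
      (fun k => Sum.elim (cmGramEntry L e dV hdV dW hdW) (-cmGramEntry L e dV hdV dW hdW) ((e₂ n).symm k)) (imagUnit L) σ)) ℂ)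
    (b : ∀ σ : {v : InfinitePlace (Fp L) // v.IsReal}, Matrix.unitaryGroup (NegIdx (signVec (cmPlaceOver L)
      (fun k => Sum.elim (cmGramEntry L e dV hdV dW hdW) (-cmGramEntry L e dV hdV dW hdW) ((e₂ n).symm k)) (imagUnit L) σ)) ℂ)
    (hkσ : ∀ σ, archUFormPi L (IsCMField.complexConj L) (n + n) (IsCMField.complexConj_ne_one L) (cmPlaceOver L) (cmPlaceOver_smul L)
        (cmPlaceOver_comap L) _ (gramD_gram_realDiagonal_entry_ne_zero L e dV hdV dW hdW hdV0 hdW0) (gramD_eq_diagonal_cm L e dV hdV dW hdW)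
        (J := hermD L e dV hdV dW hdW) rfl (complexConj_imagUnit L) (imagUnit_ne_zero L) k σ = UForm.kV _ _ (a σ, b σ)) :
    archSWValue L e dV hdV hdV0 dW hdW hdW0 eW e' dV' hdV' hdV'0 sB Y
        (archFrameGauss L e' dV hdV hdV0 (tensorFrame L dW eW dV') (tensorFrame_real L dW hdW eW dV' hdV') (tensorFrame_ne_zero L dW eW dV' hdW0 hdV'0)) (x * k) =
      ((∏ σ : {v : InfinitePlace (Fp L) // v.IsReal},
          (((a σ).1.det * (b σ).1.det) ^ M₂) ^ ((t (cmPlaceOver L σ).1 + 1) / 2)) *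
        (∏ σ : {v : InfinitePlace (Fp L) // v.IsReal},
          ((a σ).1.det ^
              Fintype.card (NegIdx fun k : Fin M₂ => embedding_of_isReal σ.2
                (⟨dV' k, (IsCMField.complexConj_eq_self_iff (K := L) (dV' k)).1 (hdV' k)⟩ : Fp L)) *
            (b σ).1.det ^
              Fintype.card (PosIdx fun k : Fin M₂ => embedding_of_isReal σ.2
                (⟨dV' k, (IsCMField.complexConj_eq_self_iff (K := L) (dV' k)).1 (hdV' k)⟩ : Fp L))))⁻¹) *
        archSWValue L e dV hdV hdV0 dW hdW hdW0 eW e' dV' hdV' hdV'0 sB Y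
          (archFrameGauss L e' dV hdV hdV0 (tensorFrame L dW eW dV') (tensorFrame_real L dW hdW eW dV' hdV') (tensorFrame_ne_zero L dW eW dV' hdW0 hdV'0)) x :=
  archSWValue_archFrameGauss_mul_right_of_kV L e dV hdV hdV0 dW hdW hdW0 eW e' dV' hdV' hdV'0 hχu hχs hsB ht hodd Y x k a b hkσ
    (fun σ k => embedding_of_isReal σ.2 (⟨dV' k, (IsCMField.complexConj_eq_self_iff (K := L) (dV' k)).1 (hdV' k)⟩ : Fp L))
    (fun _ k => (map_ne_zero _).2 fun h => hdV'0 k (congrArg Subtype.val h))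
    (fun σ j => K2LiuArchTensorPlaceSec.signVec_tensor L e dV hdV dW hdW eW e' dV' hdV' σ j)

end Character

end Summit.HodgeConjecture.HodgeConjecture.Cruxes.HLiu418.K2LiuArchTensorKTypeCharacter

end
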